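import Summits.QuantumFields.BalabanUV.T4Continuum.Support.AveragingDeficitBlockDensity
import Literature.MathematicalPhysics.QuantumFieldTheory.Balaban1983to89.MatrixNorms
import HarnessLib

/-!
# AveragingDeficitHSInner (T⁴ programme, node NE3, row NE3-R2, gen 6) — THE REAL HILBERT–SCHMIDT PAIRING `hsRe X Y = Re tr(X*Y)/N`
# ON `M_N(ℂ)`: symmetry, bilinearity, the polarisation `‖X − Y‖²_HS = ‖X‖²_HS + ‖Y‖²_HS − 2·hsRe X Y`, invariance under `Ad` of
# unitaries and Cauchy–Schwarz (file A of (γ3) — record `t4/T4-EST-NE3-R2.md` v0.7 §5)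

HONEST FRAMING (cell `pub-balaban`, T4-DAG PAGE 1; unit `b2b-balaban-t4-ne3r2-p1` = owner of BINDER-OWNERS row NE3-R2, gen 6).
The cell's T4 target is the finite-torus continuum limit of the unit-scale averaged loop expectations — NOT infinite volume, NO
mass gap, NOT Clay, NOT summit progress.  WHY.  (γ3), the covariant Gaffney∕Weitzenböck inequality on the torus that turns the
GRADIENT-paired residual R2ᴱ_w (`AveragingDeficitDualResidualW`) into the CURL-paired socket of row NE3, is a HILBERTIAN identity: the
cross terms of `Σ‖D_μφ_ν − D_νφ_μ‖²` against those of `‖Σ_μ D⁻_μφ_μ‖²` cancel after summation by parts.  The tree's norm on `M_N(ℂ)`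
is the operator norm `|·|` (B7 (19)), which is not Hilbertian; B7's `L²` norm `‖X‖² = tr X*X` (normalised Hilbert–Schmidt, the tree's
`MatrixNorms.nhsNormSq`) is, and the two compare by `‖X‖ ≤ |X| ≤ √N‖X‖` (B7 (20), tree `nhsNormSq_le_opNorm_sq`,
`opNorm_sq_le_card_mul_nhsNormSq`).  THIS FILE is the toolkit for the pairing `hsRe X Y := Re (MatrixNorms.nhsInner X Y)`.  All
[folklore], 0 sorry: §1 `hsRe`, `hsRe_self` (= `nhsNormSq`), `hsRe_comm`, additivity∕homogeneity in both slots, `nhsNormSq_sub`,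
`nhsNormSq_add`, `nhsNormSq_smul`; §2 `hsRe_Ad`, `nhsNormSq_Ad` (unitary `Ad` is an isometry of the pairing); §3 Cauchy–Schwarz
`abs_hsRe_le` (discriminant of `t ↦ ‖tX − Y‖²_HS`), `two_abs_hsRe_le`; §4 `nhsNormSq_Ad_sub_le` (`‖Ad_P X − X‖²_HS ≤ (2|P−1|)²‖X‖²_HS`),
`abs_hsRe_Ad_sub_le`.  Nothing of Bałaban's is asserted (context: [Balaban1985Averaging] (17)–(20) pp. 20–21).  ABSOLUTE RULE kept: no
printed sentence is a hypothesis.  PLACEMENT: `Summits/QuantumFields/BalabanUV/`; imports this row's `AveragingDeficitBlockDensity` and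
the tree's `MatrixNorms`; moves nothing.
-/

set_option autoImplicit false

open scoped BigOperators Matrix Matrix.Norms.L2Operator ComplexConjugate
open NormedSpace Finset

namespace Summit.QuantumFields.BalabanUV.T4Continuum.AveragingDeficitHSInner

open Literature.MathematicalPhysics.QuantumFieldTheory.Balaban1983to89
open B7Prop1Explicit B7Prop2Explicit MatrixLog UnitaryModel MatrixNorms
open T4AveragingDeficitWall hiding Site Plane Plaq Bond
open AveragingDeficitTransport (norm_Ad_of_unitary val_inv_eq_star_of_unitary)
open AveragingDeficitNearIdentity (norm_Ad_sub_le)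

noncomputable section

variable {n : Type*} [Fintype n]

/-! ## §1 The real Hilbert–Schmidt pairing -/

/-- THE REAL HILBERT–SCHMIDT PAIRING `hsRe X Y = Re tr(X*Y)` (normalised trace, B7 (17)). [cite: Balaban1985Averaging, (17) p.20] -/
def hsRe (X Y : Matrix n n ℂ) : ℝ := (nhsInner X Y).re

/-- `hsRe X Y = Re(tr(Xᴴ Y))/N`. [folklore] -/
theorem hsRe_eq (X Y : Matrix n n ℂ) : hsRe X Y = (Matrix.trace (Xᴴ * Y)).re / Fintype.card n := by
  simp [hsRe, nhsInner, ntr, Complex.div_natCast_re]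

/-- `hsRe X X = ‖X‖²_HS`. [folklore] -/
theorem hsRe_self (X : Matrix n n ℂ) : hsRe X X = nhsNormSq X := by
  rw [hsRe, nhsInner_self]; norm_cast

/-- Symmetry. [folklore] -/
theorem hsRe_comm (X Y : Matrix n n ℂ) : hsRe X Y = hsRe Y X := by
  rw [hsRe_eq, hsRe_eq]
  have h : Yᴴ * X = (Xᴴ * Y)ᴴ := by rw [Matrix.conjTranspose_mul, Matrix.conjTranspose_conjTranspose]
  rw [h, Matrix.trace_conjTranspose, Complex.star_def, Complex.conj_re]

/-- Additivity in the right slot. [folklore] -/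
theorem hsRe_add_right (X Y Z : Matrix n n ℂ) : hsRe X (Y + Z) = hsRe X Y + hsRe X Z := by
  simp only [hsRe_eq, Matrix.mul_add, Matrix.trace_add, Complex.add_re, add_div]

/-- Additivity in the left slot. [folklore] -/
theorem hsRe_add_left (X Y Z : Matrix n n ℂ) : hsRe (X + Y) Z = hsRe X Z + hsRe Y Z := by
  rw [hsRe_comm, hsRe_add_right, hsRe_comm Z X, hsRe_comm Z Y]

/-- Negation in the right slot. [folklore] -/
theorem hsRe_neg_right (X Y : Matrix n n ℂ) : hsRe X (-Y) = -hsRe X Y := by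
  simp only [hsRe_eq, Matrix.mul_neg, Matrix.trace_neg, Complex.neg_re, neg_div]

/-- Negation in the left slot. [folklore] -/
theorem hsRe_neg_left (X Y : Matrix n n ℂ) : hsRe (-X) Y = -hsRe X Y := by
  rw [hsRe_comm, hsRe_neg_right, hsRe_comm]

/-- Subtraction in the right slot. [folklore] -/
theorem hsRe_sub_right (X Y Z : Matrix n n ℂ) : hsRe X (Y - Z) = hsRe X Y - hsRe X Z := by
  rw [sub_eq_add_neg, hsRe_add_right, hsRe_neg_right, ← sub_eq_add_neg]

/-- Subtraction in the left slot. [folklore] -/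
theorem hsRe_sub_left (X Y Z : Matrix n n ℂ) : hsRe (X - Y) Z = hsRe X Z - hsRe Y Z := by
  rw [sub_eq_add_neg, hsRe_add_left, hsRe_neg_left, ← sub_eq_add_neg]

/-- Real homogeneity in the left slot. [folklore] -/
theorem hsRe_smul_left (t : ℝ) (X Y : Matrix n n ℂ) : hsRe (t • X) Y = t * hsRe X Y := by
  rw [hsRe_eq, hsRe_eq, Matrix.conjTranspose_smul, Matrix.smul_mul, Matrix.trace_smul]
  simp only [star_trivial, Complex.real_smul, Complex.mul_re, Complex.ofReal_re, Complex.ofReal_im, zero_mul, sub_zero]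
  ring

/-- `‖tX‖²_HS = t²‖X‖²_HS`. [folklore] -/
theorem nhsNormSq_smul (t : ℝ) (X : Matrix n n ℂ) : nhsNormSq (t • X) = t ^ 2 * nhsNormSq X := by
  rw [← hsRe_self, hsRe_smul_left, hsRe_comm, hsRe_smul_left, hsRe_self]; ring

/-- **POLARISATION**: `‖X − Y‖²_HS = ‖X‖²_HS + ‖Y‖²_HS − 2·hsRe X Y`. [folklore] -/
theorem nhsNormSq_sub (X Y : Matrix n n ℂ) : nhsNormSq (X - Y) = nhsNormSq X + nhsNormSq Y - 2 * hsRe X Y := by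
  rw [← hsRe_self, hsRe_sub_left, hsRe_sub_right, hsRe_sub_right, hsRe_self, hsRe_self, hsRe_comm Y X]; ring

/-- `‖X + Y‖²_HS = ‖X‖²_HS + ‖Y‖²_HS + 2·hsRe X Y`. [folklore] -/
theorem nhsNormSq_add (X Y : Matrix n n ℂ) : nhsNormSq (X + Y) = nhsNormSq X + nhsNormSq Y + 2 * hsRe X Y := by
  rw [← hsRe_self, hsRe_add_left, hsRe_add_right, hsRe_add_right, hsRe_self, hsRe_self, hsRe_comm Y X]; ring

/-! ## §2 Invariance under `Ad` of unitaries -/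

variable [DecidableEq n]

/-- For a unitary unit, `u⁻¹ = uᴴ` and `uᴴu = 1`. [folklore] -/
theorem conjTranspose_val_of_unitary {u : (Matrix n n ℂ)ˣ} (hu : u ∈ unitaryUnits (Matrix n n ℂ)) :
    ((u : Matrix n n ℂ))ᴴ = ((u⁻¹ : (Matrix n n ℂ)ˣ) : Matrix n n ℂ) := by
  rw [val_inv_eq_star_of_unitary hu]; rfl

/-- **`hsRe (Ad_u X) (Ad_u Y) = hsRe X Y`** for unitary `u`. [cite: Balaban1985Averaging, (17) p.20] -/
theorem hsRe_Ad {u : (Matrix n n ℂ)ˣ} (hu : u ∈ unitaryUnits (Matrix n n ℂ)) (X Y : Matrix n n ℂ) :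
    hsRe (Ad u X) (Ad u Y) = hsRe X Y := by
  rw [hsRe_eq, hsRe_eq]
  congr 2
  have hinv : (((u⁻¹ : (Matrix n n ℂ)ˣ) : Matrix n n ℂ))ᴴ = (u : Matrix n n ℂ) := by
    rw [← conjTranspose_val_of_unitary hu, Matrix.conjTranspose_conjTranspose]
  unfold Ad
  rw [Matrix.conjTranspose_mul, Matrix.conjTranspose_mul, hinv, conjTranspose_val_of_unitary hu]
  -- `(u⁻¹ᴴ Xᴴ uᴴ)(u Y u⁻¹)` ↦ `u Xᴴ (u⁻¹ u) Y u⁻¹`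
  have e : (u : Matrix n n ℂ) * (Xᴴ * ((u⁻¹ : (Matrix n n ℂ)ˣ) : Matrix n n ℂ)) * ((u : Matrix n n ℂ) * Y
      * ((u⁻¹ : (Matrix n n ℂ)ˣ) : Matrix n n ℂ)) = (u : Matrix n n ℂ) * (Xᴴ * Y) * ((u⁻¹ : (Matrix n n ℂ)ˣ) : Matrix n n ℂ) := by
    rw [show (u : Matrix n n ℂ) * (Xᴴ * ((u⁻¹ : (Matrix n n ℂ)ˣ) : Matrix n n ℂ)) * ((u : Matrix n n ℂ) * Y
        * ((u⁻¹ : (Matrix n n ℂ)ˣ) : Matrix n n ℂ))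
        = (u : Matrix n n ℂ) * Xᴴ * (((u⁻¹ : (Matrix n n ℂ)ˣ) : Matrix n n ℂ) * (u : Matrix n n ℂ)) * Y
          * ((u⁻¹ : (Matrix n n ℂ)ˣ) : Matrix n n ℂ) by noncomm_ring, Units.inv_mul]
    noncomm_ring
  rw [e, Matrix.trace_mul_cycle, Units.inv_mul, Matrix.one_mul]

/-- **`‖Ad_u X‖²_HS = ‖X‖²_HS`** for unitary `u`. [folklore] -/
theorem nhsNormSq_Ad {u : (Matrix n n ℂ)ˣ} (hu : u ∈ unitaryUnits (Matrix n n ℂ)) (X : Matrix n n ℂ) :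
    nhsNormSq (Ad u X) = nhsNormSq X := by
  rw [← hsRe_self, hsRe_Ad hu, hsRe_self]

/-! ## §3 Cauchy–Schwarz -/

omit [DecidableEq n] in
/-- **CAUCHY–SCHWARZ**: `|hsRe X Y| ≤ ‖X‖_HS·‖Y‖_HS` (discriminant of `t ↦ ‖tX − Y‖²_HS ≥ 0`). [folklore] -/
theorem abs_hsRe_le (X Y : Matrix n n ℂ) : |hsRe X Y| ≤ nhsNorm X * nhsNorm Y := by
  have hquad : ∀ t : ℝ, 0 ≤ nhsNormSq X * (t * t) + (-(2 * hsRe X Y)) * t + nhsNormSq Y := by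
    intro t
    have h := nhsNormSq_nonneg (t • X - Y)
    rw [nhsNormSq_sub, nhsNormSq_smul, hsRe_smul_left] at h
    nlinarith
  have hdisc := discrim_le_zero hquad
  rw [discrim] at hdisc
  have hsq : hsRe X Y ^ 2 ≤ nhsNormSq X * nhsNormSq Y := by nlinarith
  rw [← Real.sqrt_sq_eq_abs]
  calc Real.sqrt (hsRe X Y ^ 2) ≤ Real.sqrt (nhsNormSq X * nhsNormSq Y) := Real.sqrt_le_sqrt hsq
    _ = nhsNorm X * nhsNorm Y := by rw [Real.sqrt_mul (nhsNormSq_nonneg X)]; rfl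

omit [DecidableEq n] in
/-- `2|hsRe X Y| ≤ ‖X‖²_HS + ‖Y‖²_HS`. [folklore] -/
theorem two_abs_hsRe_le (X Y : Matrix n n ℂ) : 2 * |hsRe X Y| ≤ nhsNormSq X + nhsNormSq Y := by
  have h := abs_hsRe_le X Y
  nlinarith [sq_nonneg (nhsNorm X - nhsNorm Y), nhsNorm_sq X, nhsNorm_sq Y, nhsNorm_nonneg X, nhsNorm_nonneg Y]

omit [DecidableEq n] in
/-- WEIGHTED: `2|hsRe X Y| ≤ ‖X‖_HS²/ε… ` in the product form `2|hsRe X Y| ≤ 2‖X‖_HS‖Y‖_HS`. [folklore] -/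
theorem two_abs_hsRe_le_mul (X Y : Matrix n n ℂ) : 2 * |hsRe X Y| ≤ 2 * (nhsNorm X * nhsNorm Y) := by
  linarith [abs_hsRe_le X Y]

/-! ## §4 Near-identity transports in the Hilbert–Schmidt norm -/

/-- `‖Ad_P X − X‖_HS ≤ 2|P − 1|·‖X‖_HS` for a unitary `P` (operator norm on `P − 1`). [folklore] -/
theorem nhsNorm_Ad_sub_le [Nonempty n] {P : (Matrix n n ℂ)ˣ} (hP : P ∈ unitaryUnits (Matrix n n ℂ)) (X : Matrix n n ℂ) :
    nhsNorm (Ad P X - X) ≤ 2 * ‖(P : Matrix n n ℂ) - 1‖ * nhsNorm X := by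
  -- `Ad_P X − X = (P − 1) X P⁻¹ + X (P⁻¹ − 1)`
  have e : Ad P X - X = ((P : Matrix n n ℂ) - 1) * X * ((P⁻¹ : (Matrix n n ℂ)ˣ) : Matrix n n ℂ)
      + X * (((P⁻¹ : (Matrix n n ℂ)ˣ) : Matrix n n ℂ) - 1) := by
    unfold Ad; noncomm_ring
  rw [e]
  have hPi : ‖((P⁻¹ : (Matrix n n ℂ)ˣ) : Matrix n n ℂ)‖ = 1 :=
    CStarRing.norm_of_mem_unitary (mem_unitaryUnits.mp ((unitaryUnits _).inv_mem hP))
  have hPi1 : ‖((P⁻¹ : (Matrix n n ℂ)ˣ) : Matrix n n ℂ) - 1‖ ≤ ‖(P : Matrix n n ℂ) - 1‖ :=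
    norm_inv_sub_one_le (AveragingDeficitTransport.mem_U1_of_unitary hP)
  have htri : nhsNorm (((P : Matrix n n ℂ) - 1) * X * ((P⁻¹ : (Matrix n n ℂ)ˣ) : Matrix n n ℂ)
      + X * (((P⁻¹ : (Matrix n n ℂ)ˣ) : Matrix n n ℂ) - 1))
      ≤ nhsNorm (((P : Matrix n n ℂ) - 1) * X * ((P⁻¹ : (Matrix n n ℂ)ˣ) : Matrix n n ℂ))
        + nhsNorm (X * (((P⁻¹ : (Matrix n n ℂ)ˣ) : Matrix n n ℂ) - 1)) := by
    -- triangle inequality for the HS norm via the polarisation and Cauchy–Schwarz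
    set A := ((P : Matrix n n ℂ) - 1) * X * ((P⁻¹ : (Matrix n n ℂ)ˣ) : Matrix n n ℂ)
    set B := X * (((P⁻¹ : (Matrix n n ℂ)ˣ) : Matrix n n ℂ) - 1)
    have h := nhsNormSq_add A B
    have hcs := abs_hsRe_le A B
    have hA := nhsNorm_nonneg A
    have hB := nhsNorm_nonneg B
    have hsq : nhsNormSq (A + B) ≤ (nhsNorm A + nhsNorm B) ^ 2 := by
      rw [h, add_sq, nhsNorm_sq, nhsNorm_sq]; linarith [le_abs_self (hsRe A B)]
    calc nhsNorm (A + B) = Real.sqrt (nhsNormSq (A + B)) := rfl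
      _ ≤ Real.sqrt ((nhsNorm A + nhsNorm B) ^ 2) := Real.sqrt_le_sqrt hsq
      _ = nhsNorm A + nhsNorm B := Real.sqrt_sq (by positivity)
  refine htri.trans ?_
  have h1 : nhsNorm (((P : Matrix n n ℂ) - 1) * X * ((P⁻¹ : (Matrix n n ℂ)ˣ) : Matrix n n ℂ))
      ≤ ‖(P : Matrix n n ℂ) - 1‖ * nhsNorm X := by
    calc _ ≤ nhsNorm (((P : Matrix n n ℂ) - 1) * X) * ‖((P⁻¹ : (Matrix n n ℂ)ˣ) : Matrix n n ℂ)‖ :=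
          nhsNorm_mul_le_nhsNorm_mul_opNorm _ _
      _ ≤ ‖(P : Matrix n n ℂ) - 1‖ * nhsNorm X * 1 := by
          rw [hPi]; exact mul_le_mul_of_nonneg_right (nhsNorm_mul_le_opNorm_mul_nhsNorm _ _) zero_le_one
      _ = _ := by ring
  have h2 : nhsNorm (X * (((P⁻¹ : (Matrix n n ℂ)ˣ) : Matrix n n ℂ) - 1)) ≤ ‖(P : Matrix n n ℂ) - 1‖ * nhsNorm X := by
    calc _ ≤ nhsNorm X * ‖((P⁻¹ : (Matrix n n ℂ)ˣ) : Matrix n n ℂ) - 1‖ := nhsNorm_mul_le_nhsNorm_mul_opNorm _ _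
      _ ≤ nhsNorm X * ‖(P : Matrix n n ℂ) - 1‖ := mul_le_mul_of_nonneg_left hPi1 (nhsNorm_nonneg X)
      _ = _ := by ring
  linarith

/-- **`|hsRe (Ad_P X − X) Y| ≤ 2|P − 1|·‖X‖_HS·‖Y‖_HS`**. [folklore] -/
theorem abs_hsRe_Ad_sub_le [Nonempty n] {P : (Matrix n n ℂ)ˣ} (hP : P ∈ unitaryUnits (Matrix n n ℂ)) (X Y : Matrix n n ℂ) :
    |hsRe (Ad P X - X) Y| ≤ 2 * ‖(P : Matrix n n ℂ) - 1‖ * nhsNorm X * nhsNorm Y := by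
  refine (abs_hsRe_le _ Y).trans ?_
  exact mul_le_mul_of_nonneg_right (nhsNorm_Ad_sub_le hP X) (nhsNorm_nonneg Y)

end

end Summit.QuantumFields.BalabanUV.T4Continuum.AveragingDeficitHSInner
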